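import Summits.ResolutionOfSingularities.ResolutionOfSingularities.Theorems.FrobeniusLadderFRationalResolutionAnResolutionStep
import Summits.ResolutionOfSingularities.ResolutionOfSingularities.Theorems.FrobeniusLadderFRationalResolutionAffineSpaceResolution
import Summits.ResolutionOfSingularities.ResolutionOfSingularities.Theorems.FrobeniusLadderFRationalResolutionSuspensionPowAffineSpace
import Literature.AlgebraicGeometry.Resolution.ResolutionOfComponents
import HarnessLib

/-!
# Rung 4′ on the hypersurfaces `yz + x₀^(m+1) = 0` in every dimension

Support file for crux stmt-ResolutionOfSingularities-15317 (`FrobeniusLadder.FRationalResolution`),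
line `Sketch`, continuation seat c3, wave 3, theme (B): the suspension hypersurfaces
`Σ(x₀^(m+1)) = Spec k[y, z, x₀, …, xₙ]/(yz + x₀^(m+1)) ⊂ 𝔸^(n+3)` — members of the crux's residual
class by the c2 calibration (`suspension_package`), with NON-ISOLATED singular locus
`{y = z = x₀ = 0} ≅ 𝔸ⁿ` for `m ≥ 1` — HAVE A RESOLUTION OF SINGULARITIES, for every field `k` and all
`n, m`: `Σ(x₀^(m+1)) ≅ 𝔸ⁿ × A_m` (`stub_suspensionPow_affineSpace_iso`, p141473), `A_m` is resolved by
the tower of point blow-ups (`hasResolution_An`), and resolutions pull back along affine spaces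
(`hasResolution_affineSpace`, p148038). [folklore]
-/

-- single-problem summit: the doubled namespace component is forced
set_option linter.dupNamespace false

noncomputable section

namespace Summit.ResolutionOfSingularities.ResolutionOfSingularities.Theorems.FRationalResolution

open CategoryTheory AlgebraicGeometry TopologicalSpace
open Literature.AlgebraicGeometry.Resolution

/-- **RUNG 4′ ON `Σ(x₀^(m+1)) ⊂ 𝔸^(n+3)`, EVERY FIELD, ALL `n, m`.** The hypersurface
`Spec k[y, z, x₀, …, xₙ]/(yz + x₀^(m+1))` (c2 suspension convention: `MvPolynomial (Fin 2 ⊕ Fin (n+1)) k`,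
`y = X (inl 0)`, `z = X (inl 1)`, `xᵢ = X (inr i)`) has a resolution of singularities: it is
`𝔸ⁿ × A_m`, and `A_m` is resolved by `⌈m/2⌉` point blow-ups. The first resolved members of the
residual class with non-isolated singularities. [folklore; Kollár 2007 §2.2] -/
theorem hasResolution_suspensionPow (k : Type) [Field k] (n m : ℕ) :
    Scheme.HasResolution (Spec (CommRingCat.of (MvPolynomial (Fin 2 ⊕ Fin (n + 1)) k ⧸ Ideal.span
      {(MvPolynomial.X (Sum.inl 0) * MvPolynomial.X (Sum.inl 1) +
        MvPolynomial.rename Sum.inr (MvPolynomial.X 0 ^ (m + 1)) :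
          MvPolynomial (Fin 2 ⊕ Fin (n + 1)) k)}))) := by
  obtain ⟨e⟩ := stub_suspensionPow_affineSpace_iso k n m
  exact Scheme.HasResolution.of_iso e.inv
    (hasResolution_affineSpace n _ (hasResolution_An k m))

end Summit.ResolutionOfSingularities.ResolutionOfSingularities.Theorems.FRationalResolution

end
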